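import Literature.MathematicalPhysics.QuantumFieldTheory.BalabanImbrieJaffe1984to88.BIJ88Sect2Statements

/-!
# `BalabanImbrieJaffe1984to88.BIJ88ScaleSums` — T. Bałaban, J. Imbrie, A. Jaffe, *Effective action and cluster properties of
the abelian Higgs model*, Commun. Math. Phys. **114** (1988) 257–315 [BalabanImbrieJaffe1988]: the MULTISCALE ARITHMETIC of the
running charge (2.2) *"e_k = (L^kε)^{(4−d)/2}e"* and the localization length (2.3) *"r(e_k) = |log e_k⁻¹|^r, r > 1"* behind every
*"sum over j"* / *"sum over m"* of Sect. 5.7 (pp. 291–295) and the knitted bound **(5.7.14)** p. 295 — kernel-checked support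
lemmas (theorem-only; no statement of the paper is asserted here).

statement-level skeleton of published theorems with citation tags; proofs where landed; nothing here is a claim about the Yang–Mills mass gap

PDF held: `paper:balaban1988-cmp114-bij-abelian-higgs-effective-action` (journal page = PDF page + 256).  Pages read as images:
PDF pp. 4 (journal 260: (2.2), (2.3)) and 33–39 (journal 289–295), `g4png.py` ×2 renders (seat folder `renders/`).

CITATION HEADER (lean-in-tree rule).  Part of the lit-balaban TYPED SKELETON (HOME `run/shared/lean/pub/lit-balaban/`), Phase 2,
seat p36 (gen 4, unit `lit-balaban-p36`); support file for row **C2.Eq5.7.13-5.7.15** ((5.7.14), proved in the companion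
`BIJ88Ineq5714Proof`) of `HOME/lit-balaban-r16/ROWS-C2-part2.md`.  WHAT IS HERE (every constant explicit):
* §1 for running charges scaling geometrically, `e_j = e_k q^{k−j}`, `0 < q < 1` (abstract `e : ℕ → ℝ`): `0 < e_j ≤ e_k`;
  `e_j^κ = e_k^κ (q^κ)^{k−j}`; **`Σ_{j≤k} e_j^κ ≤ e_k^κ/(1 − q^κ)`** (`κ > 0`); `log e_j⁻¹ = log e_k⁻¹ + (k−j) log q⁻¹`; the tangent
  (Bernoulli) inequality `a^r + r a^{r−1} t ≤ (a + t)^r` (`a, t ≥ 0`, `r > 1`; Mathlib `one_add_mul_self_le_rpow_one_add`), whence for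
  (2.3) `r(e) = |log e⁻¹|^r` (`BIJ88Sect2Statements.rLen`) and `e_k ≤ 1`: `r(e_j) ≥ r(e_k) + r (log e_k⁻¹)^{r−1} (k−j) log q⁻¹`; hence
  **`Σ_{j≤k} e^{−c r(e_j) n} ≤ 2 e^{−c r(e_k) n}`** for every `n ≥ 1` once the per-scale gain `c·r·(log e_k⁻¹)^{r−1}·log q⁻¹ ≥ log 2`
  (`e_k` small); and **`e^{−c r(e_k)} ≤ e_k^κ`** once `κ ≤ c (log e_k⁻¹)^{r−1}` (p. 291: *"We can take κ arbitrarily large"*).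
* §2 the instance of record: r18's (2.2) `BIJ88Sect2Statements.eK L ε e d j` scales with **`q = L^{−(4−d)/2}`**
  (`eK_scale : e_j = e_k · (L^{−(4−d)/2})^{k−j}`), `log q⁻¹ = ((4−d)/2) log L`, and `0 < q < 1` for `L > 1`, `d < 4`.
No new `Prop` facts; axioms standard.
-/

namespace Literature.MathematicalPhysics.QuantumFieldTheory.BalabanImbrieJaffe1984to88.BIJ88ScaleSums

open Finset
open BIJ88Sect2Statements (rLen eK)

/-! ## §1 Multiscale arithmetic for `e_j = e_k q^{k−j}` and `r(e) = |log e⁻¹|^r` -/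

section ScaleArith

variable {e : ℕ → ℝ} {q : ℝ} {k : ℕ}

/-- Running charges scaling geometrically across scales, `e_j = e_k q^{k−j}` with `0 < q ≤ 1` ((2.2): `q = L^{−(4−d)/2}`): `0 < e_j ≤ e_k`
for `j ≤ k`. [cite: BalabanImbrieJaffe1988, (2.2) p.260] -/
theorem scale_pos_le (he : ∀ j, j ≤ k → e j = e k * q ^ (k - j)) (hq0 : 0 < q) (hq1 : q ≤ 1) (hek : 0 < e k)
    {j : ℕ} (hj : j ≤ k) : 0 < e j ∧ e j ≤ e k := by
  rw [he j hj]
  exact ⟨mul_pos hek (pow_pos hq0 _), mul_le_of_le_one_right hek.le (pow_le_one₀ hq0.le hq1)⟩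

/-- `e_j^κ = e_k^κ (q^κ)^{k−j}`. [cite: BalabanImbrieJaffe1988, (2.2) p.260] -/
theorem rpow_scale (he : ∀ j, j ≤ k → e j = e k * q ^ (k - j)) (hq0 : 0 < q) (hek : 0 < e k) (κ : ℝ) {j : ℕ}
    (hj : j ≤ k) : e j ^ κ = e k ^ κ * (q ^ κ) ^ (k - j) := by
  rw [he j hj, Real.mul_rpow hek.le (pow_nonneg hq0.le _), ← Real.rpow_natCast q (k - j),
    ← Real.rpow_natCast (q ^ κ) (k - j), ← Real.rpow_mul hq0.le, ← Real.rpow_mul hq0.le, mul_comm ((k - j : ℕ) : ℝ) κ]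

/-- **`Σ_{j≤k} e_j^κ ≤ e_k^κ/(1 − q^κ)`** (`0 < q < 1`, `κ > 0`): the sum over scales of powers of the running charge is dominated by
the last scale. [cite: BalabanImbrieJaffe1988, (5.7.14) p.295] -/
theorem sum_rpow_scale_le (he : ∀ j, j ≤ k → e j = e k * q ^ (k - j)) (hq0 : 0 < q) (hq1 : q < 1) (hek : 0 < e k)
    {κ : ℝ} (hκ : 0 < κ) : ∑ j ∈ Finset.range (k + 1), e j ^ κ ≤ e k ^ κ / (1 - q ^ κ) := by
  have hterm : ∀ j ∈ Finset.range (k + 1), e j ^ κ = e k ^ κ * (q ^ κ) ^ (k - j) := fun j hj =>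
    rpow_scale he hq0 hek κ (Nat.lt_succ_iff.mp (Finset.mem_range.mp hj))
  rw [Finset.sum_congr rfl hterm, ← Finset.mul_sum]
  have hQ0 : 0 ≤ q ^ κ := Real.rpow_nonneg hq0.le κ
  have hQ1 : q ^ κ < 1 := Real.rpow_lt_one hq0.le hq1 hκ
  have hrefl : ∑ j ∈ Finset.range (k + 1), (q ^ κ) ^ (k - j) = ∑ m ∈ Finset.range (k + 1), (q ^ κ) ^ m := by
    have h := Finset.sum_range_reflect (fun m => (q ^ κ) ^ m) (k + 1)
    simp only [Nat.add_sub_cancel] at h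
    exact h
  have hgeom : ∑ m ∈ Finset.range (k + 1), (q ^ κ) ^ m ≤ 1 / (1 - q ^ κ) := by
    have h := geom_sum_Ico_le_of_lt_one hQ0 hQ1 (m := 0) (n := k + 1)
    rwa [pow_zero, ← Finset.range_eq_Ico] at h
  rw [hrefl, div_eq_mul_one_div]
  exact mul_le_mul_of_nonneg_left hgeom (Real.rpow_nonneg hek.le κ)

/-- `log e_j⁻¹ = log e_k⁻¹ + (k − j) log q⁻¹`. [cite: BalabanImbrieJaffe1988, (2.2) p.260] -/
theorem log_inv_scale (he : ∀ j, j ≤ k → e j = e k * q ^ (k - j)) (hq0 : 0 < q) (hek : 0 < e k) {j : ℕ} (hj : j ≤ k) :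
    Real.log (e j)⁻¹ = Real.log (e k)⁻¹ + ((k - j : ℕ) : ℝ) * Real.log q⁻¹ := by
  rw [he j hj, Real.log_inv, Real.log_inv, Real.log_inv, Real.log_mul hek.ne' (pow_pos hq0 _).ne', Real.log_pow]
  ring

/-- The tangent (Bernoulli) inequality for real exponents `r > 1`: `a^r + r a^{r−1} t ≤ (a + t)^r` for `a, t ≥ 0` (from Mathlib's
`one_add_mul_self_le_rpow_one_add`). [cite: BalabanImbrieJaffe1988, (2.3) p.260] -/
theorem rpow_add_tangent_le {a t r : ℝ} (ha : 0 ≤ a) (ht : 0 ≤ t) (hr : 1 < r) :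
    a ^ r + r * a ^ (r - 1) * t ≤ (a + t) ^ r := by
  rcases ha.eq_or_lt with h0 | ha'
  · rw [← h0, Real.zero_rpow (by linarith), Real.zero_rpow (by linarith), zero_add, mul_zero, zero_mul, zero_add]
    exact Real.rpow_nonneg ht r
  · have h1 : (a + t) ^ r = a ^ r * (1 + t / a) ^ r := by
      rw [← Real.mul_rpow ha (by positivity), mul_add, mul_one, mul_div_cancel₀ _ ha'.ne']
    have hB : 1 + r * (t / a) ≤ (1 + t / a) ^ r :=
      one_add_mul_self_le_rpow_one_add (by have := div_nonneg ht ha; linarith) hr.le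
    have h2 : a ^ r * (1 + r * (t / a)) = a ^ r + r * a ^ (r - 1) * t := by
      rw [Real.rpow_sub_one ha'.ne']
      field_simp
    calc a ^ r + r * a ^ (r - 1) * t = a ^ r * (1 + r * (t / a)) := h2.symm
      _ ≤ a ^ r * (1 + t / a) ^ r := mul_le_mul_of_nonneg_left hB (Real.rpow_nonneg ha r)
      _ = (a + t) ^ r := h1.symm

/-- **The localization length grows down the scales**: with `R_k = log e_k⁻¹ ≥ 0` (`e_k ≤ 1`) and (2.3) `r(e) = |log e⁻¹|^r`, `r > 1`:
`r(e_j) ≥ r(e_k) + r R_k^{r−1} (k−j) log q⁻¹` for `j ≤ k`. [cite: BalabanImbrieJaffe1988, (2.3) p.260] -/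
theorem rLen_scale_ge (he : ∀ j, j ≤ k → e j = e k * q ^ (k - j)) (hq0 : 0 < q) (hq1 : q ≤ 1) (hek : 0 < e k)
    (hek1 : e k ≤ 1) {r : ℝ} (hr : 1 < r) {j : ℕ} (hj : j ≤ k) :
    rLen r (e k) + r * Real.log (e k)⁻¹ ^ (r - 1) * (((k - j : ℕ) : ℝ) * Real.log q⁻¹) ≤ rLen r (e j) := by
  have hR : 0 ≤ Real.log (e k)⁻¹ := Real.log_nonneg ((one_le_inv₀ hek).mpr hek1)
  have hlq : 0 ≤ Real.log q⁻¹ := Real.log_nonneg ((one_le_inv₀ hq0).mpr hq1)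
  have ht : 0 ≤ ((k - j : ℕ) : ℝ) * Real.log q⁻¹ := mul_nonneg (Nat.cast_nonneg _) hlq
  have hRj : Real.log (e j)⁻¹ = Real.log (e k)⁻¹ + ((k - j : ℕ) : ℝ) * Real.log q⁻¹ := log_inv_scale he hq0 hek hj
  unfold rLen
  rw [hRj, abs_of_nonneg hR, abs_of_nonneg (add_nonneg hR ht)]
  exact rpow_add_tangent_le hR ht hr

/-- Per-scale gain in the exponential: for `n ≥ 1`, `c ≥ 0`,
`e^{−c r(e_j) n} ≤ e^{−c r(e_k) n} · e^{−g (k−j)}` with `g = c r R_k^{r−1} log q⁻¹`. [cite: BalabanImbrieJaffe1988, (5.7.14) p.295] -/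
theorem exp_rLen_scale_le (he : ∀ j, j ≤ k → e j = e k * q ^ (k - j)) (hq0 : 0 < q) (hq1 : q ≤ 1) (hek : 0 < e k)
    (hek1 : e k ≤ 1) {r c n : ℝ} (hr : 1 < r) (hc : 0 ≤ c) (hn : 1 ≤ n) {j : ℕ} (hj : j ≤ k) :
    Real.exp (-(c * rLen r (e j)) * n) ≤
      Real.exp (-(c * rLen r (e k)) * n) *
        Real.exp (-(c * r * Real.log (e k)⁻¹ ^ (r - 1) * Real.log q⁻¹) * ((k - j : ℕ) : ℝ)) := by
  have hR : 0 ≤ Real.log (e k)⁻¹ := Real.log_nonneg ((one_le_inv₀ hek).mpr hek1)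
  have hlq : 0 ≤ Real.log q⁻¹ := Real.log_nonneg ((one_le_inv₀ hq0).mpr hq1)
  have hgain := rLen_scale_ge he hq0 hq1 hek hek1 hr hj
  rw [← Real.exp_add]
  apply Real.exp_le_exp.mpr
  have hg0 : 0 ≤ c * r * Real.log (e k)⁻¹ ^ (r - 1) * Real.log q⁻¹ * ((k - j : ℕ) : ℝ) := by
    have : 0 ≤ Real.log (e k)⁻¹ ^ (r - 1) := Real.rpow_nonneg hR _
    have : (0 : ℝ) ≤ r := by linarith
    positivity
  -- c n r(e_j) ≥ c n r(e_k) + n·(c r R^{r-1} log q⁻¹ (k-j)) ≥ c n r(e_k) + (gain)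
  have h1 : c * (rLen r (e k) + r * Real.log (e k)⁻¹ ^ (r - 1) * (((k - j : ℕ) : ℝ) * Real.log q⁻¹)) * n
      ≤ c * rLen r (e j) * n :=
    mul_le_mul_of_nonneg_right (mul_le_mul_of_nonneg_left hgain hc) (by linarith)
  have h2 : c * r * Real.log (e k)⁻¹ ^ (r - 1) * Real.log q⁻¹ * ((k - j : ℕ) : ℝ) ≤
      c * (r * Real.log (e k)⁻¹ ^ (r - 1) * (((k - j : ℕ) : ℝ) * Real.log q⁻¹)) * n := by
    have : c * (r * Real.log (e k)⁻¹ ^ (r - 1) * (((k - j : ℕ) : ℝ) * Real.log q⁻¹)) * n =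
        (c * r * Real.log (e k)⁻¹ ^ (r - 1) * Real.log q⁻¹ * ((k - j : ℕ) : ℝ)) * n := by ring
    rw [this]
    exact le_mul_of_one_le_right hg0 hn
  nlinarith [h1, h2]

/-- **`Σ_{j≤k} e^{−c r(e_j) n} ≤ 2 e^{−c r(e_k) n}`** for every `n ≥ 1`, once `e_k ≤ 1` is so small that the per-scale gain
`c·r·(log e_k⁻¹)^{r−1}·log q⁻¹ ≥ log 2` (`r > 1`): the pieces decaying with `r(e_j)`, summed over the scales, cost a factor 2 at the
last scale. [cite: BalabanImbrieJaffe1988, (5.7.14) p.295] -/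
theorem sum_exp_rLen_scale_le (he : ∀ j, j ≤ k → e j = e k * q ^ (k - j)) (hq0 : 0 < q) (hq1 : q ≤ 1) (hek : 0 < e k)
    (hek1 : e k ≤ 1) {r c n : ℝ} (hr : 1 < r) (hc : 0 ≤ c) (hn : 1 ≤ n)
    (hg : Real.log 2 ≤ c * r * Real.log (e k)⁻¹ ^ (r - 1) * Real.log q⁻¹) :
    ∑ j ∈ Finset.range (k + 1), Real.exp (-(c * rLen r (e j)) * n) ≤ 2 * Real.exp (-(c * rLen r (e k)) * n) := by
  set g := c * r * Real.log (e k)⁻¹ ^ (r - 1) * Real.log q⁻¹ with hg_def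
  have hstep : ∀ j ∈ Finset.range (k + 1), Real.exp (-(c * rLen r (e j)) * n) ≤
      Real.exp (-(c * rLen r (e k)) * n) * (1 / 2 : ℝ) ^ (k - j) := by
    intro j hj
    have hjk : j ≤ k := Nat.lt_succ_iff.mp (Finset.mem_range.mp hj)
    refine (exp_rLen_scale_le he hq0 hq1 hek hek1 hr hc hn hjk).trans ?_
    refine mul_le_mul_of_nonneg_left ?_ (Real.exp_pos _).le
    -- e^{-g (k-j)} ≤ (1/2)^{k-j}
    have h12 : Real.exp (-g) ≤ 1 / 2 := by
      rw [Real.exp_neg, one_div]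
      exact inv_anti₀ (by norm_num) ((Real.exp_log (by norm_num : (0:ℝ) < 2)).symm.le.trans (Real.exp_le_exp.mpr hg))
    calc Real.exp (-g * ((k - j : ℕ) : ℝ)) = Real.exp (-g) ^ (k - j) := by
          rw [← Real.exp_nat_mul]; ring_nf
      _ ≤ (1 / 2 : ℝ) ^ (k - j) := pow_le_pow_left₀ (Real.exp_pos _).le h12 _
  have hrefl : ∑ j ∈ Finset.range (k + 1), (1 / 2 : ℝ) ^ (k - j) = ∑ m ∈ Finset.range (k + 1), (1 / 2 : ℝ) ^ m := by
    have h := Finset.sum_range_reflect (fun m => (1 / 2 : ℝ) ^ m) (k + 1)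
    simp only [Nat.add_sub_cancel] at h
    exact h
  have hgeom : ∑ m ∈ Finset.range (k + 1), (1 / 2 : ℝ) ^ m ≤ 2 := by
    have h := geom_sum_Ico_le_of_lt_one (by norm_num : (0:ℝ) ≤ 1 / 2) (by norm_num : (1 / 2 : ℝ) < 1) (m := 0) (n := k + 1)
    rw [pow_zero, ← Finset.range_eq_Ico] at h
    refine h.trans ?_
    norm_num
  calc ∑ j ∈ Finset.range (k + 1), Real.exp (-(c * rLen r (e j)) * n)
      ≤ ∑ j ∈ Finset.range (k + 1), Real.exp (-(c * rLen r (e k)) * n) * (1 / 2 : ℝ) ^ (k - j) := Finset.sum_le_sum hstep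
    _ = Real.exp (-(c * rLen r (e k)) * n) * ∑ m ∈ Finset.range (k + 1), (1 / 2 : ℝ) ^ m := by
        rw [← hrefl, Finset.mul_sum]
    _ ≤ Real.exp (-(c * rLen r (e k)) * n) * 2 := mul_le_mul_of_nonneg_left hgeom (Real.exp_pos _).le
    _ = 2 * Real.exp (-(c * rLen r (e k)) * n) := mul_comm _ _

/-- **`e^{−c r(e_k)} ≤ e_k^κ`** once `κ ≤ c (log e_k⁻¹)^{r−1}` (`0 < e_k ≤ 1`, `r > 1`): super-exponential smallness in the logarithmic
scale beats any power of the running charge (p. 291: *"We can take κ arbitrarily large"*). [cite: BalabanImbrieJaffe1988, (5.7.9) p.291] -/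
theorem exp_rLen_le_rpow {x r c κ : ℝ} (hx : 0 < x) (hx1 : x ≤ 1) (hr : 1 < r) (hκR : κ ≤ c * Real.log x⁻¹ ^ (r - 1)) :
    Real.exp (-(c * rLen r x)) ≤ x ^ κ := by
  have hR : 0 ≤ Real.log x⁻¹ := Real.log_nonneg ((one_le_inv₀ hx).mpr hx1)
  have hxκ : x ^ κ = Real.exp (-(κ * Real.log x⁻¹)) := by
    rw [Real.rpow_def_of_pos hx, Real.log_inv]; ring_nf
  rw [hxκ]
  apply Real.exp_le_exp.mpr
  unfold rLen
  rw [abs_of_nonneg hR]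
  have hsplit : Real.log x⁻¹ ^ r = Real.log x⁻¹ ^ (r - 1) * Real.log x⁻¹ := by
    conv_lhs => rw [show r = (r - 1) + 1 by ring]
    rw [Real.rpow_add' hR (by linarith), Real.rpow_one]
  rw [hsplit]
  have := mul_le_mul_of_nonneg_right hκR hR
  nlinarith [this]

end ScaleArith

/-! ## §2 The instance of record: (2.2) `e_j = (L^jε)^{(4−d)/2} e` scales with `q = L^{−(4−d)/2}` -/

section EK

variable {L ε e₀ : ℝ} {d : ℕ}

/-- **(2.2) scales geometrically**: `e_j = e_k · (L^{−(4−d)/2})^{k−j}` for `j ≤ k` (`L, ε > 0`).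
[cite: BalabanImbrieJaffe1988, (2.2) p.260] -/
theorem eK_scale (hL : 0 < L) (hε : 0 < ε) (e₀ : ℝ) {j k : ℕ} (hj : j ≤ k) :
    eK L ε e₀ d j = eK L ε e₀ d k * (L ^ (-((4 - (d : ℝ)) / 2))) ^ (k - j) := by
  set s : ℝ := (4 - (d : ℝ)) / 2 with hs
  have hLk : L ^ k = L ^ j * L ^ (k - j) := by rw [← pow_add, Nat.add_sub_cancel' hj]
  have h1 : (L ^ k * ε) ^ s = (L ^ j * ε) ^ s * (L ^ (k - j)) ^ s := by
    rw [hLk, mul_right_comm, Real.mul_rpow (by positivity) (by positivity)]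
  have h2 : (L ^ (k - j)) ^ s * (L ^ (-s)) ^ (k - j) = 1 := by
    rw [← Real.rpow_natCast L (k - j), ← Real.rpow_mul hL.le, ← Real.rpow_natCast (L ^ (-s)) (k - j),
      ← Real.rpow_mul hL.le, ← Real.rpow_add hL]
    ring_nf
    exact Real.rpow_zero L
  unfold eK
  rw [← hs]
  calc (L ^ j * ε) ^ s * e₀ = (L ^ j * ε) ^ s * e₀ * ((L ^ (k - j)) ^ s * (L ^ (-s)) ^ (k - j)) := by rw [h2, mul_one]
    _ = (L ^ j * ε) ^ s * (L ^ (k - j)) ^ s * e₀ * (L ^ (-s)) ^ (k - j) := by ring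
    _ = (L ^ k * ε) ^ s * e₀ * (L ^ (-s)) ^ (k - j) := by rw [← h1]

/-- the ratio of (2.2): `0 < L^{−(4−d)/2}`, and `< 1` for `L > 1`, `d < 4`. [cite: BalabanImbrieJaffe1988, (2.2) p.260] -/
theorem ratio_pos_lt_one (hL : 1 < L) (hd : d < 4) :
    0 < L ^ (-((4 - (d : ℝ)) / 2)) ∧ L ^ (-((4 - (d : ℝ)) / 2)) < 1 := by
  have hd' : (d : ℝ) < 4 := by exact_mod_cast hd
  refine ⟨Real.rpow_pos_of_pos (by linarith) _, Real.rpow_lt_one_of_one_lt_of_neg hL ?_⟩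
  have : 0 < (4 - (d : ℝ)) / 2 := by linarith
  linarith

/-- `log q⁻¹ = ((4−d)/2)·log L` for the ratio `q = L^{−(4−d)/2}` of (2.2). [cite: BalabanImbrieJaffe1988, (2.2) p.260] -/
theorem log_inv_ratio (hL : 0 < L) : Real.log (L ^ (-((4 - (d : ℝ)) / 2)))⁻¹ = (4 - (d : ℝ)) / 2 * Real.log L := by
  rw [← Real.rpow_neg hL.le, neg_neg, Real.log_rpow hL]

/-- (2.2) in the form used by §1: `∀ j ≤ k, e_j = e_k q^{k−j}` with `q = L^{−(4−d)/2}`. [cite: BalabanImbrieJaffe1988, (2.2) p.260] -/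
theorem eK_scale_family (hL : 0 < L) (hε : 0 < ε) (e₀ : ℝ) (k : ℕ) :
    ∀ j, j ≤ k → (fun i => eK L ε e₀ d i) j = (fun i => eK L ε e₀ d i) k * (L ^ (-((4 - (d : ℝ)) / 2))) ^ (k - j) :=
  fun _ hj => eK_scale hL hε e₀ hj

/-- positivity of (2.2): `0 < e_k` for `L, ε, e > 0`. [cite: BalabanImbrieJaffe1988, (2.2) p.260] -/
theorem eK_pos (hL : 0 < L) (hε : 0 < ε) (he₀ : 0 < e₀) (k : ℕ) : 0 < eK L ε e₀ d k := by
  unfold eK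
  exact mul_pos (Real.rpow_pos_of_pos (by positivity) _) he₀

/-- **`Σ_{j≤k} e_j^κ ≤ e_k^κ/(1 − L^{−(4−d)κ/2})`** for the running charge (2.2), `L > 1`, `d < 4`, `κ > 0` (the ratio written as
`(L^{−(4−d)/2})^κ`). [cite: BalabanImbrieJaffe1988, (5.7.14) p.295] -/
theorem sum_eK_rpow_le (hL : 1 < L) (hε : 0 < ε) (he₀ : 0 < e₀) (hd : d < 4) (k : ℕ) {κ : ℝ} (hκ : 0 < κ) :
    ∑ j ∈ Finset.range (k + 1), eK L ε e₀ d j ^ κ ≤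
      eK L ε e₀ d k ^ κ / (1 - (L ^ (-((4 - (d : ℝ)) / 2))) ^ κ) := by
  obtain ⟨hq0, hq1⟩ := ratio_pos_lt_one hL hd
  exact sum_rpow_scale_le (eK_scale_family (by linarith) hε e₀ k) hq0 hq1 (eK_pos (by linarith) hε he₀ k) hκ

/-- **`Σ_{j≤k} e^{−c r(e_j) n} ≤ 2 e^{−c r(e_k) n}`** (`n ≥ 1`) for the running charge (2.2) and the localization length (2.3), once
`e_k ≤ 1` and the per-scale gain `c·r·(log e_k⁻¹)^{r−1}·((4−d)/2)·log L ≥ log 2`. [cite: BalabanImbrieJaffe1988, (5.7.14) p.295] -/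
theorem sum_exp_rLen_eK_le (hL : 1 < L) (hε : 0 < ε) (he₀ : 0 < e₀) (hd : d < 4) (k : ℕ) (hek1 : eK L ε e₀ d k ≤ 1)
    {r c n : ℝ} (hr : 1 < r) (hc : 0 ≤ c) (hn : 1 ≤ n)
    (hg : Real.log 2 ≤ c * r * Real.log (eK L ε e₀ d k)⁻¹ ^ (r - 1) * ((4 - (d : ℝ)) / 2 * Real.log L)) :
    ∑ j ∈ Finset.range (k + 1), Real.exp (-(c * rLen r (eK L ε e₀ d j)) * n) ≤
      2 * Real.exp (-(c * rLen r (eK L ε e₀ d k)) * n) := by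
  obtain ⟨hq0, hq1⟩ := ratio_pos_lt_one hL hd
  have hL0 : 0 < L := by linarith
  rw [← log_inv_ratio (d := d) hL0] at hg
  exact sum_exp_rLen_scale_le (eK_scale_family hL0 hε e₀ k) hq0 hq1.le (eK_pos hL0 hε he₀ k) hek1 hr hc hn hg

end EK

end Literature.MathematicalPhysics.QuantumFieldTheory.BalabanImbrieJaffe1984to88.BIJ88ScaleSums
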